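import Mathlib
import Summits.MatrixMultiplication.MatrixMultiplication.Theses.AlgebraicSTPPDichotomy
import Literature.Combinatorics.Additive.TightTriangleRemovalSumMin
import Literature.Computability.AlgebraicComplexity.GroupTheoreticMatMulThmBProofs
import Literature.Barriers.MatrixMultiplication.TricoloredSumFreeBarrier

/-!
# Candidate proof of crux `FrameBarrier` (stmt-MatrixMultiplication-7620) — idea `cone-fourier-cap`

Ideator's evidence file (planner-cruxidea-stmt-MatrixMultiplication-7620-1-0, 2026-08-15).  NOT a
Theorems file (prover-only); a prover may port it verbatim.

Line: (L1) cone sets have all nontrivial Fourier coefficients `≤ q^m/(q-1)`; (L2) few solutions of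
`x+y+z=0` force a large coefficient; (L3) STPP bookkeeping (difference-set unions, tree's
`card_triangles_le`); (L4) the cone counting inequality `P ≤ q^m·Sol + q^{3m}/(q-1)`; (L5) finish
through the tree's `sum_rpow_le_of_packing` (BCCGNSU Lemma 2.4 chain) after extracting a packing
defect `q^{-1/8}` in one of the three pairings.  Constants: `ε_m = 1/(24(m+1))`, `q₀ = 256`.
-/

open scoped BigOperators ComplexConjugate

namespace ConeFourierCap

open Literature.Computability.AlgebraicComplexity (IsSTPP)

/-! ## §1  (L1) hyperplane-mass cap -/
section L1

variable {F : Type} [Field F] [Fintype F] {m : ℕ}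

/-- The line map `c ↦ c • x` as an additive homomorphism `F →+ F^m`. -/
def lineHom (x : Fin m → F) : F →+ (Fin m → F) where
  toFun c := c • x
  map_zero' := zero_smul F x
  map_add' a b := add_smul a b x

omit [Fintype F] in
@[simp] lemma lineHom_apply (x : Fin m → F) (c : F) : lineHom x c = c • x := rfl

/-- Restriction of `ψ` to the line through `x`: an additive character of `F`. -/
noncomputable def lineChar (ψ : AddChar (Fin m → F) ℂ) (x : Fin m → F) : AddChar F ℂ :=
  ψ.compAddMonoidHom (lineHom x)

omit [Fintype F] in
@[simp] lemma lineChar_apply (ψ : AddChar (Fin m → F) ℂ) (x : Fin m → F) (c : F) :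
    lineChar ψ x c = ψ (c • x) := rfl

/-- `K_ψ = {x | ψ is trivial on the line F·x}` as a submodule of `F^m`. -/
def kerCone (ψ : AddChar (Fin m → F) ℂ) : Submodule F (Fin m → F) where
  carrier := {x | ∀ c : F, ψ (c • x) = 1}
  add_mem' := by
    intro x y hx hy c
    simp only [Set.mem_setOf_eq] at hx hy ⊢
    rw [smul_add, AddChar.map_add_eq_mul, hx c, hy c, one_mul]
  zero_mem' := by
    intro c
    simp
  smul_mem' := by
    intro a x hx c
    simp only [Set.mem_setOf_eq] at hx ⊢
    rw [smul_smul]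
    exact hx (c * a)

omit [Fintype F] in
lemma mem_kerCone {ψ : AddChar (Fin m → F) ℂ} {x : Fin m → F} :
    x ∈ kerCone ψ ↔ ∀ c : F, ψ (c • x) = 1 := Iff.rfl

omit [Fintype F] in
lemma kerCone_ne_top {ψ : AddChar (Fin m → F) ℂ} (hψ : ψ ≠ 1) : kerCone ψ ≠ ⊤ := by
  intro h
  apply hψ
  refine DFunLike.ext ψ 1 fun x => ?_
  have hx : x ∈ kerCone ψ := h ▸ Submodule.mem_top
  simpa using (mem_kerCone.1 hx) 1

open scoped Classical in
/-- Summing `ψ` over a line: `q` if the line lies in `K_ψ`, else `0`. -/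
lemma sum_line (ψ : AddChar (Fin m → F) ℂ) (x : Fin m → F) :
    ∑ c : F, ψ (c • x) = if x ∈ kerCone ψ then (Fintype.card F : ℂ) else 0 := by
  split_ifs with h
  · rw [Finset.sum_congr rfl (fun c _ => (mem_kerCone.1 h) c)]
    simp
  · have hne : lineChar ψ x ≠ 1 := by
      intro h1
      apply h
      rw [mem_kerCone]
      intro c
      have := congrArg (fun χ : AddChar F ℂ => χ c) h1
      simpa using this
    have := AddChar.sum_eq_zero_of_ne_one hne
    simpa using this

open scoped Classical in
/-- (L1′) `(q-1)·Σ_{x∈X} ψ x = q·|X ∩ K_ψ| - |X|` for a cone `X`. -/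
theorem cone_charSum_mul (X : Finset (Fin m → F))
    (hX : ∀ c : F, c ≠ 0 → ∀ x ∈ X, c • x ∈ X) (ψ : AddChar (Fin m → F) ℂ) :
    ((Fintype.card F : ℂ) - 1) * ∑ x ∈ X, ψ x
      = (Fintype.card F : ℂ) * ((X.filter (· ∈ kerCone ψ)).card : ℂ) - (X.card : ℂ) := by
  have step1 : ∀ c : F, c ≠ 0 → ∑ x ∈ X, ψ (c • x) = ∑ x ∈ X, ψ x := by
    intro c hc
    refine Finset.sum_nbij' (fun x => c • x) (fun x => c⁻¹ • x) ?_ ?_ ?_ ?_ ?_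
    · intro x hx; exact hX c hc x hx
    · intro x hx; exact hX c⁻¹ (inv_ne_zero hc) x hx
    · intro x _; simp [smul_smul, inv_mul_cancel₀ hc]
    · intro x _; simp [smul_smul, mul_inv_cancel₀ hc]
    · intro x _; rfl
  have hcardF : ((Finset.univ.erase (0 : F)).card : ℂ) = (Fintype.card F : ℂ) - 1 := by
    rw [Finset.card_erase_of_mem (Finset.mem_univ _), Finset.card_univ,
      Nat.cast_sub Fintype.card_pos, Nat.cast_one]
  have step2 : ∑ c ∈ Finset.univ.erase (0 : F), ∑ x ∈ X, ψ (c • x)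
      = ((Fintype.card F : ℂ) - 1) * ∑ x ∈ X, ψ x := by
    rw [Finset.sum_congr rfl (fun c hc => step1 c (Finset.ne_of_mem_erase hc)),
      Finset.sum_const, nsmul_eq_mul, hcardF]
  have step3 : ∀ x : Fin m → F,
      ∑ c ∈ Finset.univ.erase (0 : F), ψ (c • x) = (∑ c : F, ψ (c • x)) - 1 := by
    intro x
    rw [Finset.sum_erase_eq_sub (Finset.mem_univ _)]
    simp
  rw [← step2, Finset.sum_comm]
  simp_rw [step3, sum_line]
  rw [Finset.sum_sub_distrib]
  simp only [Finset.sum_const, nsmul_eq_mul, mul_one]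
  rw [← Finset.sum_filter, Finset.sum_const, nsmul_eq_mul, mul_comm]

open scoped Classical in
/-- `q · |X ∩ K_ψ| ≤ q^m` because `K_ψ` is a proper subspace. -/
lemma card_mul_filter_kerCone_le (X : Finset (Fin m → F)) {ψ : AddChar (Fin m → F) ℂ}
    (hψ : ψ ≠ 1) :
    Fintype.card F * (X.filter (· ∈ kerCone ψ)).card ≤ Fintype.card F ^ m := by
  set K := kerCone ψ with hK
  have h1 : (X.filter (· ∈ K)).card ≤ Fintype.card K := by
    calc (X.filter (· ∈ K)).card ≤ (Finset.univ.filter (fun x : Fin m → F => x ∈ K)).card :=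
          Finset.card_le_card (Finset.filter_subset_filter _ (Finset.subset_univ X))
      _ = Fintype.card K := by
          rw [Fintype.card_subtype]
  have h2 : Fintype.card K = Fintype.card F ^ Module.finrank F K := Module.card_eq_pow_finrank
  have h3 : Module.finrank F K < m := by
    have := Submodule.finrank_lt (kerCone_ne_top hψ)
    simpa [hK, Module.finrank_fin_fun] using this
  have hq : 1 ≤ Fintype.card F := Fintype.card_pos
  calc Fintype.card F * (X.filter (· ∈ K)).card
      ≤ Fintype.card F * Fintype.card F ^ Module.finrank F K := by
        rw [← h2]; exact Nat.mul_le_mul_left _ h1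
    _ = Fintype.card F ^ (Module.finrank F K + 1) := by ring
    _ ≤ Fintype.card F ^ m := Nat.pow_le_pow_right hq (by omega)

open scoped Classical in
/-- **(L1) Hyperplane-mass cap.**  For a cone `X ⊆ F^m` and a nontrivial additive character
`ψ` of `F^m`:  `‖Σ_{x∈X} ψ x‖ ≤ q^m/(q-1)`. -/
theorem hyperplane_mass_cap (X : Finset (Fin m → F)) (hX : ∀ c : F, c ≠ 0 → ∀ x ∈ X, c • x ∈ X)
    (ψ : AddChar (Fin m → F) ℂ) (hψ : ψ ≠ 1) :
    ‖∑ x ∈ X, ψ x‖ ≤ (Fintype.card F : ℝ) ^ m / ((Fintype.card F : ℝ) - 1) := by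
  have hq1 : (1 : ℝ) < Fintype.card F := by exact_mod_cast Fintype.one_lt_card
  have hpos : (0 : ℝ) < (Fintype.card F : ℝ) - 1 := sub_pos.2 hq1
  rw [le_div_iff₀ hpos]
  have key := cone_charSum_mul X hX ψ
  have hnorm : ‖((Fintype.card F : ℂ) - 1) * ∑ x ∈ X, ψ x‖
      = ((Fintype.card F : ℝ) - 1) * ‖∑ x ∈ X, ψ x‖ := by
    rw [norm_mul]
    congr 1
    rw [show ((Fintype.card F : ℂ) - 1) = (((Fintype.card F : ℝ) - 1 : ℝ) : ℂ) by push_cast; ring,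
      Complex.norm_real, Real.norm_eq_abs, abs_of_pos hpos]
  rw [mul_comm, ← hnorm, key]
  have hk := card_mul_filter_kerCone_le X hψ
  have hn : X.card ≤ Fintype.card F ^ m := by
    calc X.card ≤ Fintype.card (Fin m → F) := Finset.card_le_univ X
      _ = Fintype.card F ^ m := by rw [Fintype.card_fun, Fintype.card_fin]
  have hk' : (Fintype.card F : ℝ) * ((X.filter (· ∈ kerCone ψ)).card : ℝ)
      ≤ (Fintype.card F : ℝ) ^ m := by exact_mod_cast hk
  have hn' : (X.card : ℝ) ≤ (Fintype.card F : ℝ) ^ m := by exact_mod_cast hn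
  have hcast : (Fintype.card F : ℂ) * ((X.filter (· ∈ kerCone ψ)).card : ℂ) - (X.card : ℂ)
      = (((Fintype.card F : ℝ) * ((X.filter (· ∈ kerCone ψ)).card : ℝ) - (X.card : ℝ) : ℝ) : ℂ) := by
    push_cast; ring
  rw [hcast, Complex.norm_real, Real.norm_eq_abs, abs_le]
  constructor
  · have : (0 : ℝ) ≤ (Fintype.card F : ℝ) * ((X.filter (· ∈ kerCone ψ)).card : ℝ) := by positivity
    linarith
  · have : (0 : ℝ) ≤ (X.card : ℝ) := by positivity
    linarith

end L1

/-! ## §2  (L2) few solutions force a large coefficient -/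
section L2

variable {G : Type} [AddCommGroup G] [Fintype G] [DecidableEq G]

/-- Fourier coefficient of (the indicator of) a finset at a character. -/
noncomputable def fhat (X : Finset G) (ψ : AddChar G ℂ) : ℂ := ∑ x ∈ X, ψ x

omit [Fintype G] [DecidableEq G] in
@[simp] lemma fhat_one (X : Finset G) : fhat X 1 = X.card := by
  simp [fhat]

/-- Number of solutions of `x + y + z = 0` on `X × Y × Z`, as an iterated indicator sum. -/
def sol (X Y Z : Finset G) : ℕ :=
  ∑ x ∈ X, ∑ y ∈ Y, ∑ z ∈ Z, if x + y + z = 0 then 1 else 0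

omit [Fintype G] in
/-- `sol` as the cardinality of the filtered triple product. -/
lemma sol_eq_card_filter (X Y Z : Finset G) :
    sol X Y Z = ((X ×ˢ (Y ×ˢ Z)).filter fun p : G × G × G => p.1 + p.2.1 + p.2.2 = 0).card := by
  rw [Finset.card_filter, Finset.sum_product]
  simp only [sol]
  refine Finset.sum_congr rfl fun x _ => ?_
  rw [Finset.sum_product]

/-- Orthogonality turns `Σ_ψ X̂ Ŷ Ẑ` into `|G| · sol`. -/
lemma sum_fhat_mul_fhat_mul_fhat (X Y Z : Finset G) :
    ∑ ψ : AddChar G ℂ, fhat X ψ * fhat Y ψ * fhat Z ψ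
      = (Fintype.card G : ℂ) * (sol X Y Z : ℂ) := by
  have h1 : ∀ ψ : AddChar G ℂ, fhat X ψ * fhat Y ψ * fhat Z ψ
      = ∑ x ∈ X, ∑ y ∈ Y, ∑ z ∈ Z, ψ (x + y + z) := by
    intro ψ
    rw [fhat, fhat, fhat, Finset.sum_mul_sum, Finset.sum_mul]
    refine Finset.sum_congr rfl fun x _ => ?_
    rw [Finset.sum_mul]
    refine Finset.sum_congr rfl fun y _ => ?_
    rw [Finset.mul_sum]
    refine Finset.sum_congr rfl fun z _ => ?_
    rw [AddChar.map_add_eq_mul, AddChar.map_add_eq_mul]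
  simp_rw [h1]
  rw [Finset.sum_comm]
  simp_rw [Finset.sum_comm (s := (Finset.univ : Finset (AddChar G ℂ))) (t := Y),
    Finset.sum_comm (s := (Finset.univ : Finset (AddChar G ℂ))) (t := Z),
    AddChar.sum_apply_eq_ite]
  simp only [sol]
  push_cast
  rw [Finset.mul_sum]
  refine Finset.sum_congr rfl fun x _ => ?_
  rw [Finset.mul_sum]
  refine Finset.sum_congr rfl fun y _ => ?_
  rw [Finset.mul_sum]
  refine Finset.sum_congr rfl fun z _ => ?_
  split_ifs <;> simp

/-- Parseval for the indicator of a finset: `Σ_ψ ‖Ŷ ψ‖² = |G|·|Y|`. -/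
lemma sum_norm_fhat_sq (Y : Finset G) :
    ∑ ψ : AddChar G ℂ, ‖fhat Y ψ‖ ^ 2 = (Fintype.card G : ℝ) * Y.card := by
  have key : ∀ ψ : AddChar G ℂ, ((‖fhat Y ψ‖ : ℂ)) ^ 2 = ∑ y ∈ Y, ∑ y' ∈ Y, ψ (y + -y') := by
    intro ψ
    rw [← Complex.mul_conj', fhat, map_sum, Finset.sum_mul_sum]
    refine Finset.sum_congr rfl fun y _ => Finset.sum_congr rfl fun y' _ => ?_
    rw [AddChar.map_add_eq_mul, AddChar.map_neg_eq_conj]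
  have : ((∑ ψ : AddChar G ℂ, ‖fhat Y ψ‖ ^ 2 : ℝ) : ℂ)
      = (((Fintype.card G : ℝ) * Y.card : ℝ) : ℂ) := by
    push_cast
    simp_rw [key]
    rw [Finset.sum_comm]
    simp_rw [Finset.sum_comm (s := (Finset.univ : Finset (AddChar G ℂ))) (t := Y),
      AddChar.sum_apply_eq_ite, add_neg_eq_zero, Finset.sum_ite_eq]
    rw [Finset.sum_congr rfl fun y hy => if_pos hy]
    simp [mul_comm]
  exact_mod_cast this

/-- **(L2)** `|X||Y||Z| ≤ |G|·sol + |G|·M·√(|Y||Z|)` whenever `M ≥ 0` bounds the nontrivial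
Fourier coefficients of `X`. -/
theorem card_mul_le_sol_add (X Y Z : Finset G) {M : ℝ} (hM0 : 0 ≤ M)
    (hM : ∀ ψ : AddChar G ℂ, ψ ≠ 1 → ‖fhat X ψ‖ ≤ M) :
    ((X.card : ℝ) * Y.card * Z.card)
      ≤ (Fintype.card G : ℝ) * (sol X Y Z : ℝ)
        + (Fintype.card G : ℝ) * M * Real.sqrt ((Y.card : ℝ) * Z.card) := by
  have hsplit := sum_fhat_mul_fhat_mul_fhat X Y Z
  rw [← Finset.add_sum_erase _ _ (Finset.mem_univ (1 : AddChar G ℂ))] at hsplit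
  simp only [fhat_one] at hsplit
  set R : ℂ := ∑ ψ ∈ Finset.univ.erase (1 : AddChar G ℂ), fhat X ψ * fhat Y ψ * fhat Z ψ with hR
  have hreal : (X.card : ℝ) * Y.card * Z.card = (Fintype.card G : ℝ) * (sol X Y Z) - R.re := by
    have h := congrArg Complex.re hsplit
    rw [Complex.add_re] at h
    have h3 : ((X.card : ℂ) * (Y.card : ℂ) * (Z.card : ℂ)).re = (X.card : ℝ) * Y.card * Z.card := by
      norm_cast
    have h4 : ((Fintype.card G : ℂ) * (sol X Y Z : ℂ)).re = (Fintype.card G : ℝ) * (sol X Y Z) := by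
      norm_cast
    linarith [h3, h4]
  have hRle : ‖R‖ ≤ M * ∑ ψ : AddChar G ℂ, ‖fhat Y ψ‖ * ‖fhat Z ψ‖ := by
    calc ‖R‖ ≤ ∑ ψ ∈ Finset.univ.erase (1 : AddChar G ℂ), ‖fhat X ψ * fhat Y ψ * fhat Z ψ‖ :=
          norm_sum_le _ _
      _ ≤ ∑ ψ ∈ Finset.univ.erase (1 : AddChar G ℂ), M * (‖fhat Y ψ‖ * ‖fhat Z ψ‖) := by
          refine Finset.sum_le_sum fun ψ hψ => ?_
          rw [norm_mul, norm_mul, mul_assoc]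
          exact mul_le_mul_of_nonneg_right (hM ψ (Finset.ne_of_mem_erase hψ))
            (mul_nonneg (norm_nonneg _) (norm_nonneg _))
      _ ≤ ∑ ψ : AddChar G ℂ, M * (‖fhat Y ψ‖ * ‖fhat Z ψ‖) := by
          refine Finset.sum_le_sum_of_subset_of_nonneg (Finset.erase_subset _ _) ?_
          intro ψ _ _
          exact mul_nonneg hM0 (mul_nonneg (norm_nonneg _) (norm_nonneg _))
      _ = M * ∑ ψ : AddChar G ℂ, ‖fhat Y ψ‖ * ‖fhat Z ψ‖ := by rw [Finset.mul_sum]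
  have hCS : ∑ ψ : AddChar G ℂ, ‖fhat Y ψ‖ * ‖fhat Z ψ‖
      ≤ Real.sqrt ((Fintype.card G : ℝ) * Y.card) * Real.sqrt ((Fintype.card G : ℝ) * Z.card) := by
    rw [← sum_norm_fhat_sq Y, ← sum_norm_fhat_sq Z]
    exact Real.sum_mul_le_sqrt_mul_sqrt _ _ _
  have hsqrt : Real.sqrt ((Fintype.card G : ℝ) * Y.card) * Real.sqrt ((Fintype.card G : ℝ) * Z.card)
      = (Fintype.card G : ℝ) * Real.sqrt ((Y.card : ℝ) * Z.card) := by
    rw [← Real.sqrt_mul (by positivity)]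
    rw [show (Fintype.card G : ℝ) * Y.card * ((Fintype.card G : ℝ) * Z.card)
        = ((Fintype.card G : ℝ) * (Fintype.card G : ℝ)) * ((Y.card : ℝ) * Z.card) by ring]
    rw [Real.sqrt_mul (by positivity), Real.sqrt_mul_self (by positivity)]
  have hRre : -R.re ≤ ‖R‖ := by
    have := Complex.abs_re_le_norm R
    rw [abs_le] at this
    linarith [this.1]
  calc (X.card : ℝ) * Y.card * Z.card
      = (Fintype.card G : ℝ) * (sol X Y Z) - R.re := hreal
    _ ≤ (Fintype.card G : ℝ) * (sol X Y Z) + ‖R‖ := by linarith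
    _ ≤ (Fintype.card G : ℝ) * (sol X Y Z) + M * ((Fintype.card G : ℝ) * Real.sqrt ((Y.card : ℝ) * Z.card)) := by
        have := hRle.trans (mul_le_mul_of_nonneg_left hCS hM0)
        rw [hsqrt] at this
        linarith
    _ = _ := by ring

end L2

/-! ## §3  (L3) STPP bookkeeping over a set `Fu` of blocks -/
section L3

open Literature.Combinatorics.Additive (diffSet mem_diffSet)

variable {H : Type} [AddCommGroup H] [DecidableEq H] {N : ℕ}

/-- (L3a) Under STPP, with `C i` nonempty for `i ∈ Fu`, `(i,a,b) ↦ a - b` is injective on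
`⊔_{i∈Fu} A i × B i`, so `Σ_{i∈Fu} |A i||B i| ≤ |⋃_{i∈Fu} (A i - B i)|`. -/
theorem sum_card_mul_le_card_biUnion_diffSet {A B C : Fin N → Finset H} (h : IsSTPP A B C)
    (Fu : Finset (Fin N)) (hC : ∀ i ∈ Fu, (C i).Nonempty) :
    ∑ i ∈ Fu, (A i).card * (B i).card ≤ (Fu.biUnion fun i => diffSet (A i) (B i)).card := by
  set D : Finset (Σ _ : Fin N, H × H) := Fu.sigma fun i => A i ×ˢ B i with hD
  have hinj : Set.InjOn (fun x : (Σ _ : Fin N, H × H) => x.2.1 - x.2.2) ↑D := by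
    rintro ⟨i, a, b⟩ hx ⟨j, a', b'⟩ hy (he : a - b = a' - b')
    simp only [hD, Finset.coe_sigma, Set.mem_sigma_iff, Finset.coe_product, Set.mem_prod,
      Finset.mem_coe] at hx hy
    obtain ⟨c, hc⟩ := hC j hy.1
    have key : (a - a') + (b' - b) + (c - c) = 0 := by
      have : (a - a') + (b' - b) + (c - c) = (a - b) - (a' - b') := by abel
      rw [this, he, sub_self]
    obtain ⟨hij, -, h3, h4, -⟩ := h i j j a' hy.2.1 a hx.2.1 b hx.2.2 b' hy.2.2 c hc c hc key
    subst hij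
    rw [← h3, h4]
  calc ∑ i ∈ Fu, (A i).card * (B i).card = D.card := by
        rw [hD, Finset.card_sigma]; simp only [Finset.card_product]
    _ = (D.image fun x : (Σ _ : Fin N, H × H) => x.2.1 - x.2.2).card :=
        (Finset.card_image_of_injOn hinj).symm
    _ ≤ (Fu.biUnion fun i => diffSet (A i) (B i)).card := by
        refine Finset.card_le_card fun x hx => ?_
        rw [Finset.mem_image] at hx
        obtain ⟨⟨i, a, b⟩, hmem, rfl⟩ := hx
        simp only [hD, Finset.mem_sigma, Finset.mem_product] at hmem
        rw [Finset.mem_biUnion]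
        exact ⟨i, hmem.1, mem_diffSet.2 ⟨a, hmem.2.1, b, hmem.2.2, rfl⟩⟩

/-- (L3c) Cones are preserved by difference-set unions. -/
theorem biUnion_diffSet_cone {F : Type} [Field F] [DecidableEq F] {m : ℕ} {A B : Fin N → Finset (Fin m → F)}
    (Fu : Finset (Fin N))
    (hA : ∀ i (c : F), c ≠ 0 → ∀ x ∈ A i, c • x ∈ A i)
    (hB : ∀ i (c : F), c ≠ 0 → ∀ x ∈ B i, c • x ∈ B i) :
    ∀ c : F, c ≠ 0 → ∀ x ∈ (Fu.biUnion fun i => diffSet (A i) (B i)),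
      c • x ∈ (Fu.biUnion fun i => diffSet (A i) (B i)) := by
  intro c hc x hx
  rw [Finset.mem_biUnion] at hx ⊢
  obtain ⟨i, hi, hx⟩ := hx
  obtain ⟨a, ha, b, hb, rfl⟩ := mem_diffSet.1 hx
  exact ⟨i, hi, mem_diffSet.2 ⟨c • a, hA i c hc a ha, c • b, hB i c hc b hb, (smul_sub c a b).symm⟩⟩

end L3

/-! ## §4  (L4) the cone counting inequality -/
section L4

open Literature.Combinatorics.Additive (diffSet mem_diffSet card_triangles_le)

variable {F : Type} [Field F] [Fintype F] [DecidableEq F] {m N : ℕ}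

/-- **(L4′)** For an STPP family of cones in `F^m` and a set `Fu` of blocks with all three sets
nonempty: `S_X · S_Y · S_Z ≤ q^m · Sol + (q^m)^3/(q-1)` (sums over `Fu`). -/
theorem cone_counting {A B C : Fin N → Finset (Fin m → F)} (hS : IsSTPP A B C)
    (Fu : Finset (Fin N))
    (hA : ∀ i ∈ Fu, (A i).Nonempty) (hB : ∀ i ∈ Fu, (B i).Nonempty)
    (hC : ∀ i ∈ Fu, (C i).Nonempty)
    (hAc : ∀ i (c : F), c ≠ 0 → ∀ x ∈ A i, c • x ∈ A i)
    (hBc : ∀ i (c : F), c ≠ 0 → ∀ x ∈ B i, c • x ∈ B i) :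
    (∑ i ∈ Fu, ((A i).card * (B i).card : ℕ) : ℝ) *
        (∑ i ∈ Fu, ((B i).card * (C i).card : ℕ) : ℝ) *
          (∑ i ∈ Fu, ((C i).card * (A i).card : ℕ) : ℝ)
      ≤ (Fintype.card F : ℝ) ^ m * (∑ i ∈ Fu, ((A i).card * (B i).card * (C i).card : ℕ) : ℝ)
        + ((Fintype.card F : ℝ) ^ m) ^ 3 / ((Fintype.card F : ℝ) - 1) := by
  -- names
  set SX : ℝ := (∑ i ∈ Fu, ((A i).card * (B i).card : ℕ) : ℝ) with hSX
  set SY : ℝ := (∑ i ∈ Fu, ((B i).card * (C i).card : ℕ) : ℝ) with hSY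
  set SZ : ℝ := (∑ i ∈ Fu, ((C i).card * (A i).card : ℕ) : ℝ) with hSZ
  set Sol : ℝ := (∑ i ∈ Fu, ((A i).card * (B i).card * (C i).card : ℕ) : ℝ) with hSol
  set q : ℝ := (Fintype.card F : ℝ) with hq
  have hSX0 : 0 ≤ SX := by rw [hSX]; exact Finset.sum_nonneg fun i _ => Nat.cast_nonneg _
  have hSY0 : 0 ≤ SY := by rw [hSY]; exact Finset.sum_nonneg fun i _ => Nat.cast_nonneg _
  have hSZ0 : 0 ≤ SZ := by rw [hSZ]; exact Finset.sum_nonneg fun i _ => Nat.cast_nonneg _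
  have hq1 : (1 : ℝ) < q := by rw [hq]; exact_mod_cast Fintype.one_lt_card
  have hq0 : (0 : ℝ) ≤ q := by linarith
  have hqm0 : (0 : ℝ) ≤ q ^ m := pow_nonneg hq0 m
  have hcardG : (Fintype.card (Fin m → F) : ℝ) = q ^ m := by
    rw [Fintype.card_fun, Fintype.card_fin]; push_cast; rfl
  -- tree facts and injectivity, stated on the explicit unions
  have h_tri := card_triangles_le hS Fu
  have h_inX := sum_card_mul_le_card_biUnion_diffSet hS Fu hC
  have h_inY := sum_card_mul_le_card_biUnion_diffSet hS.rotate Fu hA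
  have h_inZ := sum_card_mul_le_card_biUnion_diffSet hS.rotate.rotate Fu hB
  have hXcone := biUnion_diffSet_cone (A := A) (B := B) Fu hAc hBc
  -- name the three difference-set unions (abstracted everywhere, including the facts above)
  set X : Finset (Fin m → F) := Fu.biUnion fun i => diffSet (A i) (B i) with hX
  set Y : Finset (Fin m → F) := Fu.biUnion fun i => diffSet (B i) (C i) with hY
  set Z : Finset (Fin m → F) := Fu.biUnion fun i => diffSet (C i) (A i) with hZ
  -- Fourier side
  obtain ⟨M, hM⟩ : ∃ M : ℝ, M = q ^ m / (q - 1) := ⟨_, rfl⟩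
  have hM0 : 0 ≤ M := by rw [hM]; exact div_nonneg hqm0 (by linarith)
  have hMX : ∀ ψ : AddChar (Fin m → F) ℂ, ψ ≠ 1 → ‖fhat X ψ‖ ≤ M := fun ψ hψ => by
    rw [hM, hq]; exact hyperplane_mass_cap X hXcone ψ hψ
  have hL2 := card_mul_le_sol_add X Y Z hM0 hMX
  rw [hcardG] at hL2
  -- solutions: sol ≤ Sol
  have hsol : (sol X Y Z : ℝ) ≤ Sol := by
    have h2 : sol X Y Z ≤ ∑ i ∈ Fu, (A i).card * (B i).card * (C i).card := by
      rw [sol_eq_card_filter]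
      convert h_tri using 2
    rw [hSol]; exact_mod_cast h2
  -- sizes from below (injectivity)
  have hXge : SX ≤ X.card := by rw [hSX]; exact_mod_cast h_inX
  have hYge : SY ≤ Y.card := by rw [hSY]; exact_mod_cast h_inY
  have hZge : SZ ≤ Z.card := by rw [hSZ]; exact_mod_cast h_inZ
  -- sizes from above (trivial)
  have hYle : (Y.card : ℝ) ≤ q ^ m := by
    rw [← hcardG]; exact_mod_cast Finset.card_le_univ Y
  have hZle : (Z.card : ℝ) ≤ q ^ m := by
    rw [← hcardG]; exact_mod_cast Finset.card_le_univ Z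
  have hY0 : (0 : ℝ) ≤ Y.card := Nat.cast_nonneg _
  have hZ0 : (0 : ℝ) ≤ Z.card := Nat.cast_nonneg _
  have hXc0 : (0 : ℝ) ≤ X.card := Nat.cast_nonneg _
  have hsqrt : Real.sqrt ((Y.card : ℝ) * Z.card) ≤ q ^ m := by
    calc Real.sqrt ((Y.card : ℝ) * Z.card) ≤ Real.sqrt (q ^ m * q ^ m) :=
          Real.sqrt_le_sqrt (mul_le_mul hYle hZle hZ0 hqm0)
      _ = q ^ m := Real.sqrt_mul_self hqm0
  -- assemble
  have step1 : SX * SY * SZ ≤ (X.card : ℝ) * Y.card * Z.card :=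
    mul_le_mul (mul_le_mul hXge hYge hSY0 hXc0) hZge hSZ0 (mul_nonneg hXc0 hY0)
  have step4 : q ^ m * M * q ^ m = (q ^ m) ^ 3 / (q - 1) := by
    rw [hM]
    have : q - 1 ≠ 0 := by linarith
    field_simp
  have step3 : q ^ m * (sol X Y Z : ℝ) + q ^ m * M * Real.sqrt ((Y.card : ℝ) * Z.card)
      ≤ q ^ m * Sol + (q ^ m) ^ 3 / (q - 1) := by
    rw [← step4]
    exact add_le_add (mul_le_mul_of_nonneg_left hsol hqm0)
      (mul_le_mul_of_nonneg_left hsqrt (mul_nonneg hqm0 hM0))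
  exact step1.trans (hL2.trans step3)

end L4

/-! ## §5  (L5) finish: a packing defect in one pairing, then BCCGNSU Lemma 2.4 -/
section L5

open Literature.Barriers.MatrixMultiplication (sum_rpow_le_of_packing)

/-- From a packing defect `Σ ab ≤ n/r ≤ n^{1-3ε'}` in the first pairing to the final bound. -/
theorem finish_of_defect {ι : Type} (S : Finset ι) (a b c : ι → ℝ)
    (ha : ∀ i, 0 ≤ a i) (hb : ∀ i, 0 ≤ b i) (hc : ∀ i, 0 ≤ c i)
    {n t ε' : ℝ} (hn : 1 ≤ n) (hε' : 0 ≤ ε')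
    (hab : ∑ i ∈ S, a i * b i ≤ t) (ht : t ≤ n ^ (1 - 3 * ε'))
    (hbc : ∑ i ∈ S, b i * c i ≤ n) (hca : ∑ i ∈ S, c i * a i ≤ n)
    (hblock : ∀ i ∈ S, a i * b i * c i ≤ n) (hpos : ∀ i ∈ S, 0 < a i * b i * c i) :
    ∑ i ∈ S, (a i * b i * c i) ^ ((2 + ε') / 3) ≤ n := by
  have hn0 : 0 < n := by linarith
  have h23 : ∑ i ∈ S, (a i * b i * c i) ^ ((2 : ℝ) / 3) ≤ n ^ (1 - ε') := by
    have := sum_rpow_le_of_packing S a b c ha hb hc hn0 (ε := ε') (w := 2)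
      (hab.trans ht) hbc hca (le_refl _)
    have h22 : ((2 : ℝ) / 2) = 1 := by norm_num
    rw [h22, Real.rpow_one] at this
    exact this
  have hterm : ∀ i ∈ S, (a i * b i * c i) ^ ((2 + ε') / 3)
      ≤ (a i * b i * c i) ^ ((2 : ℝ) / 3) * n ^ (ε' / 3) := by
    intro i hi
    have hx := hpos i hi
    rw [show (2 + ε') / 3 = (2 : ℝ) / 3 + ε' / 3 by ring, Real.rpow_add hx]
    exact mul_le_mul_of_nonneg_left
      (Real.rpow_le_rpow hx.le (hblock i hi) (by linarith)) (Real.rpow_nonneg hx.le _)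
  calc ∑ i ∈ S, (a i * b i * c i) ^ ((2 + ε') / 3)
      ≤ ∑ i ∈ S, (a i * b i * c i) ^ ((2 : ℝ) / 3) * n ^ (ε' / 3) := Finset.sum_le_sum hterm
    _ = (∑ i ∈ S, (a i * b i * c i) ^ ((2 : ℝ) / 3)) * n ^ (ε' / 3) := by
        rw [Finset.sum_mul]
    _ ≤ n ^ (1 - ε') * n ^ (ε' / 3) :=
        mul_le_mul_of_nonneg_right h23 (Real.rpow_nonneg hn0.le _)
    _ = n ^ (1 - 2 * ε' / 3) := by
        rw [← Real.rpow_add hn0]; ring_nf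
    _ ≤ n ^ (1 : ℝ) := Real.rpow_le_rpow_of_exponent_le hn (by linarith)
    _ = n := Real.rpow_one n

open Literature.Combinatorics.Additive (sum_card_mul_card_le_card sq_sum_card_mul_le)

/-- **The crux `FrameBarrier` (stmt-MatrixMultiplication-7620)** with `ε_m = 1/(24(m+1))` and
`q₀ = 256`. -/
theorem frameBarrier :
    Summit.MatrixMultiplication.MatrixMultiplication.Theses.AlgebraicSTPPDichotomy.FrameBarrier := by
  intro m
  obtain ⟨ε, hε⟩ : ∃ ε : ℝ, ε = 1 / (24 * ((m : ℝ) + 1)) := ⟨_, rfl⟩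
  have hε0 : 0 < ε := by rw [hε]; positivity
  refine ⟨ε, hε0, 256, ?_⟩
  intro F _ _ hq N V W U A B C hA hB hC hS
  classical
  have hθ0 : (2 + ε) / 3 ≠ 0 := by positivity
  -- the degenerate rank `m = 0`: every block is empty
  rcases Nat.eq_zero_or_pos m with hm0 | hm
  · subst hm0
    have hAempty : ∀ i, A i = ∅ := fun i =>
      Finset.eq_empty_of_forall_notMem fun v hv => ((hA i v).1 hv).2 (Subsingleton.elim v 0)
    have : ∀ i, (((A i).card * (B i).card * (C i).card : ℕ) : ℝ) ^ ((2 + ε) / 3) = 0 := by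
      intro i
      rw [hAempty i, Finset.card_empty, zero_mul, zero_mul, Nat.cast_zero, Real.zero_rpow hθ0]
    calc ∑ i, (((A i).card * (B i).card * (C i).card : ℕ) : ℝ) ^ ((2 + ε) / 3)
        = 0 := Finset.sum_eq_zero fun i _ => this i
      _ ≤ (Fintype.card F : ℝ) ^ 0 := by positivity
  -- basic quantities
  set q : ℝ := (Fintype.card F : ℝ) with hqdef
  have hq256 : (256 : ℝ) ≤ q := by rw [hqdef]; exact_mod_cast hq
  have hq1 : (1 : ℝ) ≤ q := by linarith
  have hq0 : (0 : ℝ) < q := by linarith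
  set n : ℝ := q ^ m with hndef
  have hn1 : (1 : ℝ) ≤ n := one_le_pow₀ hq1
  have hn0 : (0 : ℝ) < n := by linarith
  have hcardG : Fintype.card (Fin m → F) = Fintype.card F ^ m := by
    rw [Fintype.card_fun, Fintype.card_fin]
  have hcardGr : (Fintype.card (Fin m → F) : ℝ) = n := by
    rw [hcardG]; push_cast; rfl
  -- cones
  have hAc : ∀ i (c : F), c ≠ 0 → ∀ x ∈ A i, c • x ∈ A i := by
    intro i c hc x hx
    obtain ⟨hxV, hx0⟩ := (hA i x).1 hx
    exact (hA i (c • x)).2 ⟨Submodule.smul_mem _ c hxV, smul_ne_zero hc hx0⟩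
  have hBc : ∀ i (c : F), c ≠ 0 → ∀ x ∈ B i, c • x ∈ B i := by
    intro i c hc x hx
    obtain ⟨hxV, hx0⟩ := (hB i x).1 hx
    exact (hB i (c • x)).2 ⟨Submodule.smul_mem _ c hxV, smul_ne_zero hc hx0⟩
  have hCc : ∀ i (c : F), c ≠ 0 → ∀ x ∈ C i, c • x ∈ C i := by
    intro i c hc x hx
    obtain ⟨hxV, hx0⟩ := (hC i x).1 hx
    exact (hC i (c • x)).2 ⟨Submodule.smul_mem _ c hxV, smul_ne_zero hc hx0⟩
  -- full blocks
  set Fu : Finset (Fin N) :=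
    Finset.univ.filter fun i => (A i).Nonempty ∧ (B i).Nonempty ∧ (C i).Nonempty with hFu
  have hAne : ∀ i ∈ Fu, (A i).Nonempty := fun i hi => (Finset.mem_filter.1 hi).2.1
  have hBne : ∀ i ∈ Fu, (B i).Nonempty := fun i hi => (Finset.mem_filter.1 hi).2.2.1
  have hCne : ∀ i ∈ Fu, (C i).Nonempty := fun i hi => (Finset.mem_filter.1 hi).2.2.2
  -- reduce the sum to full blocks
  have hne : ∀ i ∈ (Finset.univ : Finset (Fin N)),
      (((A i).card * (B i).card * (C i).card : ℕ) : ℝ) ^ ((2 + ε) / 3) ≠ 0 →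
        (A i).Nonempty ∧ (B i).Nonempty ∧ (C i).Nonempty := by
    intro i _ hne
    by_contra hnot
    apply hne
    have hzero : (A i).card * (B i).card * (C i).card = 0 := by
      simp only [not_and_or, Finset.not_nonempty_iff_eq_empty] at hnot
      rcases hnot with h | h | h <;> simp [h]
    rw [hzero, Nat.cast_zero, Real.zero_rpow hθ0]
  rw [← Finset.sum_filter_of_ne hne]
  -- real-valued sizes
  set a : Fin N → ℝ := fun i => ((A i).card : ℝ) with hadef
  set b : Fin N → ℝ := fun i => ((B i).card : ℝ) with hbdef
  set c : Fin N → ℝ := fun i => ((C i).card : ℝ) with hcdef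
  have ha : ∀ i, 0 ≤ a i := fun i => Nat.cast_nonneg _
  have hb : ∀ i, 0 ≤ b i := fun i => Nat.cast_nonneg _
  have hc : ∀ i, 0 ≤ c i := fun i => Nat.cast_nonneg _
  have hgoal : ∀ i, (((A i).card * (B i).card * (C i).card : ℕ) : ℝ) = a i * b i * c i := by
    intro i; push_cast; rfl
  simp_rw [hgoal]
  change ∑ i ∈ Fu, (a i * b i * c i) ^ ((2 + ε) / 3) ≤ n
  -- tree bounds: packing in the three pairings, Sol² ≤ n³, per-block abc ≤ n
  have hpX : ∑ i ∈ Fu, a i * b i ≤ n := by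
    have h := sum_card_mul_card_le_card hS (F := Fu) hCne
    rw [hcardG] at h
    have h' : ((∑ i ∈ Fu, (A i).card * (B i).card : ℕ) : ℝ) ≤ ((Fintype.card F ^ m : ℕ) : ℝ) := by
      exact_mod_cast h
    push_cast at h'
    exact h'
  have hpY : ∑ i ∈ Fu, b i * c i ≤ n := by
    have h := sum_card_mul_card_le_card hS.rotate (F := Fu) hAne
    rw [hcardG] at h
    have h' : ((∑ i ∈ Fu, (B i).card * (C i).card : ℕ) : ℝ) ≤ ((Fintype.card F ^ m : ℕ) : ℝ) := by
      exact_mod_cast h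
    push_cast at h'
    exact h'
  have hpZ : ∑ i ∈ Fu, c i * a i ≤ n := by
    have h := sum_card_mul_card_le_card hS.rotate.rotate (F := Fu) hBne
    rw [hcardG] at h
    have h' : ((∑ i ∈ Fu, (C i).card * (A i).card : ℕ) : ℝ) ≤ ((Fintype.card F ^ m : ℕ) : ℝ) := by
      exact_mod_cast h
    push_cast at h'
    exact h'
  set Sol : ℝ := ∑ i ∈ Fu, a i * b i * c i with hSoldef
  have hSol0 : 0 ≤ Sol := Finset.sum_nonneg fun i _ => mul_nonneg (mul_nonneg (ha i) (hb i)) (hc i)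
  have hSol2 : Sol ^ 2 ≤ n ^ 3 := by
    have h := sq_sum_card_mul_le hS (F := Fu) hAne hBne hCne
    rw [hcardG] at h
    have h' : (((∑ i ∈ Fu, (A i).card * (B i).card * (C i).card) ^ 2 : ℕ) : ℝ)
        ≤ (((Fintype.card F ^ m) ^ 3 : ℕ) : ℝ) := by exact_mod_cast h
    push_cast at h'
    exact h'
  have hblock : ∀ i ∈ Fu, a i * b i * c i ≤ n := by
    intro i _
    have h := Literature.Combinatorics.Additive.AddSimultaneousTPP.card_mul_card_mul_card_le
      ((Literature.Computability.AlgebraicComplexity.isSTPP_iff_addSimultaneousTPP A B C).1 hS) i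
    rw [hcardG] at h
    have h' : (((A i).card * (B i).card * (C i).card : ℕ) : ℝ) ≤ ((Fintype.card F ^ m : ℕ) : ℝ) := by
      exact_mod_cast h
    push_cast at h'
    exact h'
  have hpos : ∀ i ∈ Fu, 0 < a i * b i * c i := by
    intro i hi
    have h1 : 0 < a i := by simp only [hadef]; exact_mod_cast (hAne i hi).card_pos
    have h2 : 0 < b i := by simp only [hbdef]; exact_mod_cast (hBne i hi).card_pos
    have h3 : 0 < c i := by simp only [hcdef]; exact_mod_cast (hCne i hi).card_pos
    positivity
  -- (L4′): the cone counting inequality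
  have hP : (∑ i ∈ Fu, a i * b i) * (∑ i ∈ Fu, b i * c i) * (∑ i ∈ Fu, c i * a i)
      ≤ n * Sol + n ^ 3 / (q - 1) := by
    have h := cone_counting hS Fu hAne hBne hCne hAc hBc
    push_cast at h
    exact h
  -- numerics: r = q^{1/8} ≥ 2, n = r^{8m}
  set r : ℝ := q ^ ((1 : ℝ) / 8) with hrdef
  have hr0 : 0 < r := Real.rpow_pos_of_pos hq0 _
  have hr8 : r ^ 8 = q := by
    rw [hrdef, ← Real.rpow_natCast, ← Real.rpow_mul hq0.le]
    norm_num
  have hr2 : (2 : ℝ) ≤ r := by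
    by_contra hlt
    push Not at hlt
    have : r ^ 8 < (2 : ℝ) ^ 8 := pow_lt_pow_left₀ hlt hr0.le (by norm_num)
    rw [hr8] at this
    norm_num at this
    linarith
  have hr1 : (1 : ℝ) ≤ r := by linarith
  obtain ⟨k, rfl⟩ : ∃ k, m = k + 1 := ⟨m - 1, by omega⟩
  have hnr : n = r ^ (8 * (k + 1)) := by
    rw [hndef, pow_mul, hr8]
  -- P ≤ (n/r)^3
  have hSol_le : Sol ≤ n * r ^ (4 * (k + 1)) := by
    have hsq : Sol ^ 2 ≤ (n * r ^ (4 * (k + 1))) ^ 2 := by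
      have : (n * r ^ (4 * (k + 1))) ^ 2 = n ^ 3 := by
        rw [hnr]; ring
      rw [this]; exact hSol2
    exact le_of_pow_le_pow_left₀ (by norm_num) (by positivity) hsq
  have hclaim1 : n * Sol ≤ (n / r) ^ 3 / 2 := by
    have hrk : (2 : ℝ) ≤ r ^ (4 * k + 1) := by
      calc (2 : ℝ) ≤ r := hr2
        _ = r ^ 1 := (pow_one r).symm
        _ ≤ r ^ (4 * k + 1) := pow_le_pow_right₀ hr1 (by omega)
    have key : 2 * r ^ (4 * (k + 1) + 3) ≤ r ^ (8 * (k + 1)) := by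
      have : r ^ (8 * (k + 1)) = r ^ (4 * (k + 1) + 3) * r ^ (4 * k + 1) := by
        rw [← pow_add]; ring_nf
      rw [this]
      have h0 : 0 ≤ r ^ (4 * (k + 1) + 3) := by positivity
      nlinarith
    calc n * Sol ≤ n * (n * r ^ (4 * (k + 1))) := mul_le_mul_of_nonneg_left hSol_le hn0.le
      _ = (n / r) ^ 3 / 2 * (2 * r ^ (4 * (k + 1) + 3) / r ^ (8 * (k + 1))) := by
          rw [← hnr]; field_simp; ring
      _ ≤ (n / r) ^ 3 / 2 * 1 := by
          apply mul_le_mul_of_nonneg_left _ (by positivity)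
          rw [div_le_one (by positivity)]
          exact key
      _ = (n / r) ^ 3 / 2 := mul_one _
  have hclaim2 : n ^ 3 / (q - 1) ≤ (n / r) ^ 3 / 2 := by
    have hq1' : 0 < q - 1 := by linarith
    have h8 : (8 : ℝ) ≤ r ^ 3 := by
      have := pow_le_pow_left₀ (by norm_num : (0 : ℝ) ≤ 2) hr2 3
      norm_num at this
      exact this
    have h32 : (32 : ℝ) ≤ r ^ 5 := by
      have := pow_le_pow_left₀ (by norm_num : (0 : ℝ) ≤ 2) hr2 5
      norm_num at this
      exact this
    have h85 : 32 * r ^ 3 ≤ r ^ 8 := by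
      have hr3 : (0 : ℝ) ≤ r ^ 3 := by positivity
      calc 32 * r ^ 3 ≤ r ^ 5 * r ^ 3 := mul_le_mul_of_nonneg_right h32 hr3
        _ = r ^ 8 := by rw [← pow_add]
    have key : 2 * r ^ 3 ≤ q - 1 := by rw [← hr8]; linarith
    have hr3pos : (0 : ℝ) < r ^ 3 := by positivity
    rw [div_pow, div_div, div_le_div_iff₀ hq1' (by positivity)]
    calc n ^ 3 * (r ^ 3 * 2) = n ^ 3 * (2 * r ^ 3) := by ring
      _ ≤ n ^ 3 * (q - 1) := mul_le_mul_of_nonneg_left key (by positivity)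
  have hPt : (∑ i ∈ Fu, a i * b i) * (∑ i ∈ Fu, b i * c i) * (∑ i ∈ Fu, c i * a i)
      ≤ (n / r) ^ 3 := by linarith
  -- the defect threshold `t = n/r` is below `n^{1-3ε}`
  set t : ℝ := n / r with htdef
  have ht0 : 0 ≤ t := by positivity
  have htn : t ≤ n ^ (1 - 3 * ε) := by
    have hexp : (↑(k + 1) : ℝ) * (3 * ε) ≤ 1 / 8 := by
      rw [hε]
      have hm1 : (0 : ℝ) < (↑(k + 1) : ℝ) + 1 := by positivity
      rw [show (↑(k + 1) : ℝ) * (3 * (1 / (24 * ((↑(k + 1) : ℝ) + 1))))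
          = (↑(k + 1) : ℝ) / (8 * ((↑(k + 1) : ℝ) + 1)) by field_simp; ring]
      rw [div_le_div_iff₀ (by positivity) (by norm_num)]
      nlinarith
    have hn3 : n ^ (3 * ε) ≤ r := by
      rw [hndef, ← Real.rpow_natCast q (k + 1), ← Real.rpow_mul hq0.le, hrdef]
      exact Real.rpow_le_rpow_of_exponent_le hq1 hexp
    have hn3pos : 0 < n ^ (3 * ε) := Real.rpow_pos_of_pos hn0 _
    rw [Real.rpow_sub hn0, Real.rpow_one, htdef]
    exact div_le_div_of_nonneg_left hn0.le hn3pos hn3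
  -- one of the three pairings has a packing defect
  have hSX0 : 0 ≤ ∑ i ∈ Fu, a i * b i := Finset.sum_nonneg fun i _ => mul_nonneg (ha i) (hb i)
  have hSY0 : 0 ≤ ∑ i ∈ Fu, b i * c i := Finset.sum_nonneg fun i _ => mul_nonneg (hb i) (hc i)
  have hSZ0 : 0 ≤ ∑ i ∈ Fu, c i * a i := Finset.sum_nonneg fun i _ => mul_nonneg (hc i) (ha i)
  rcases le_or_gt (∑ i ∈ Fu, a i * b i) t with hx | hx
  · exact finish_of_defect Fu a b c ha hb hc hn1 hε0.le hx htn hpY hpZ hblock hpos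
  rcases le_or_gt (∑ i ∈ Fu, b i * c i) t with hy | hy
  · have h := finish_of_defect Fu b c a hb hc ha hn1 hε0.le hy htn hpZ hpX
      (fun i hi => by rw [show b i * c i * a i = a i * b i * c i by ring]; exact hblock i hi)
      (fun i hi => by rw [show b i * c i * a i = a i * b i * c i by ring]; exact hpos i hi)
    calc ∑ i ∈ Fu, (a i * b i * c i) ^ ((2 + ε) / 3)
        = ∑ i ∈ Fu, (b i * c i * a i) ^ ((2 + ε) / 3) :=
          Finset.sum_congr rfl fun i _ => by rw [show b i * c i * a i = a i * b i * c i by ring]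
      _ ≤ n := h
  have hz : ∑ i ∈ Fu, c i * a i ≤ t := by
    by_contra hz
    push Not at hz
    have : t * t * t < (∑ i ∈ Fu, a i * b i) * (∑ i ∈ Fu, b i * c i) * (∑ i ∈ Fu, c i * a i) :=
      mul_lt_mul'' (mul_lt_mul'' hx hy ht0 ht0) hz (mul_nonneg ht0 ht0) ht0
    have ht3 : t * t * t = t ^ 3 := by ring
    linarith
  have h := finish_of_defect Fu c a b hc ha hb hn1 hε0.le hz htn hpX hpY
    (fun i hi => by rw [show c i * a i * b i = a i * b i * c i by ring]; exact hblock i hi)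
    (fun i hi => by rw [show c i * a i * b i = a i * b i * c i by ring]; exact hpos i hi)
  calc ∑ i ∈ Fu, (a i * b i * c i) ^ ((2 + ε) / 3)
      = ∑ i ∈ Fu, (c i * a i * b i) ^ ((2 + ε) / 3) :=
        Finset.sum_congr rfl fun i _ => by rw [show c i * a i * b i = a i * b i * c i by ring]
    _ ≤ n := h

end L5

/-! ## §6  Corollaries for the route: the target is refuted, the line case follows -/
section L6

open Summit.MatrixMultiplication.MatrixMultiplication.Theses.AlgebraicSTPPDichotomy

/-- The route target `ExactFrameDesign` (stmt-MatrixMultiplication-9721) is FALSE: it is literally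
`¬ FrameBarrier` (support item `FrameBarrierIffNotExact`, stmt-9753). -/
theorem not_exactFrameDesign : ¬ ExactFrameDesign := by
  rintro ⟨m, hm⟩
  obtain ⟨ε, hε, q₀, h⟩ := frameBarrier m
  obtain ⟨F, instF, instFt, hq, N, V, W, U, A, B, C, hA, hB, hC, hS, hlt⟩ := hm ε hε q₀
  have hle := h F hq N V W U A B C hA hB hC hS
  exact absurd hlt (not_lt.2 hle)

/-- `FrameBarrier ↔ ¬ ExactFrameDesign` (support item stmt-9753), for the record. -/
theorem frameBarrierIffNotExact : FrameBarrierIffNotExact := by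
  constructor
  · intro _; exact not_exactFrameDesign
  · intro _; exact frameBarrier

/-- The line case `LineFrameBarrier` (crux stmt-MatrixMultiplication-7622): a punctured line
`{t • a | t ≠ 0}` is the punctured span `(F ∙ a) ∖ 0` (support item `FrameToLine`, stmt-7627). -/
theorem lineFrameBarrier : LineFrameBarrier := by
  intro m
  obtain ⟨ε, hε, q₀, h⟩ := frameBarrier m
  refine ⟨ε, hε, q₀, ?_⟩
  intro F _ _ hq N a b c A B C hA hB hC hS
  have key : ∀ (x : Fin N → (Fin m → F)) (X : Fin N → Finset (Fin m → F)),
      (∀ i v, v ∈ X i ↔ v ≠ 0 ∧ ∃ t : F, v = t • x i) →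
        ∀ i v, v ∈ X i ↔ v ∈ (F ∙ x i) ∧ v ≠ 0 := by
    intro x X hX i v
    rw [hX i v, Submodule.mem_span_singleton]
    constructor
    · rintro ⟨hv, t, rfl⟩
      exact ⟨⟨t, rfl⟩, hv⟩
    · rintro ⟨⟨t, rfl⟩, hv⟩
      exact ⟨hv, t, rfl⟩
  exact h F hq N (fun i => F ∙ a i) (fun i => F ∙ b i) (fun i => F ∙ c i) A B C
    (key a A hA) (key b B hB) (key c C hC) hS

/-- `FrameBarrier → LineFrameBarrier` (support item stmt-7627), for the record. -/
theorem frameToLine : FrameToLine := fun _ => lineFrameBarrier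

end L6

end ConeFourierCap
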